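import Mathlib
import HarnessLib

/-!
# `NoHeavyLowerTail` (stmt-CriticalPhenomena-4575) — swap family: the child edge lies below the least F-class (U1-PROOF §5 (Φ3); blueprint §G6)

Support file (prover `prim-gen-swap` gen 13; `--supports stmt-CriticalPhenomena-4575`).  No definitions, no named facts, no sorries.

For a swap unit `(S, X)` whose configuration has a least F-class `J ∉ Ch` (the case `y(S) = 0`): if the target `insert A (S.erase X)` satisfies the
credit condition `y = 1` (no F-class, or its least F-class is a child edge), then `A < J` (`swap_child_lt_jstar`) — the second disjunct of
`swap_targets_one_port`'s case hypothesis — and consequently `A ∉ S` (`swap_child_not_mem_of_jstar`), as `swap_weight_ge` requires.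

* `StarSet.swap_child_lt_jstar`, `StarSet.swap_child_not_mem_of_jstar`.
-/

namespace Summit.CriticalPhenomena.PercolationContinuityZ3.Theorems

open Finset

namespace StarSet

variable {ι V : Type*} [LinearOrder ι]

/-- **The child edge of a credit target lies below the least F-class of the configuration** (when that class is not a child edge). -/
theorem swap_child_lt_jstar (P : ι → V) (r : V) (F : Finset ι) {S : Finset ι} {X A J : ι}
    (hXF : X ∉ F) (hJS : J ∈ S) (hJF : J ∈ F) (hJmin : ∀ I ∈ S, I ∈ F → J ≤ I) (hJr : P J ≠ r)
    (hy1 : (∀ I ∈ F, I ∉ insert A (S.erase X)) ∨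
      ∃ a ∈ F, P a = r ∧ a ∈ insert A (S.erase X) ∧ ∀ b ∈ F, b < a → b ∉ insert A (S.erase X)) : A < J := by
  have hJX : J ≠ X := fun h => hXF (h ▸ hJF)
  have hJt : J ∈ insert A (S.erase X) := mem_insert_of_mem (mem_erase.2 ⟨hJX, hJS⟩)
  rcases hy1 with h | ⟨a, haF, har, hat, hmin⟩
  · exact absurd hJt (h J hJF)
  · have haJ : a ≤ J := by
      by_contra hlt
      exact hmin J hJF (lt_of_not_ge hlt) hJt
    have hne : a ≠ J := fun h => hJr (h ▸ har)
    have haltJ : a < J := lt_of_le_of_ne haJ hne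
    rcases mem_insert.1 hat with rfl | haS
    · exact haltJ
    · exact absurd (hJmin a (mem_of_mem_erase haS) haF) (not_le.2 haltJ)

/-- **Hence the child edge is not in the configuration** (it would be an F-class of `S` below the least one). -/
theorem swap_child_not_mem_of_jstar (P : ι → V) (r : V) (F : Finset ι) {S : Finset ι} {X A J : ι}
    (hXF : X ∉ F) (hJS : J ∈ S) (hJF : J ∈ F) (hJmin : ∀ I ∈ S, I ∈ F → J ≤ I) (hJr : P J ≠ r) (hAF : A ∈ F)
    (hy1 : (∀ I ∈ F, I ∉ insert A (S.erase X)) ∨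
      ∃ a ∈ F, P a = r ∧ a ∈ insert A (S.erase X) ∧ ∀ b ∈ F, b < a → b ∉ insert A (S.erase X)) : A ∉ S := by
  intro hAS
  have hlt := swap_child_lt_jstar P r F hXF hJS hJF hJmin hJr hy1
  exact absurd (hJmin A hAS hAF) (not_le.2 hlt)

end StarSet

end Summit.CriticalPhenomena.PercolationContinuityZ3.Theorems
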